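import Mathlib
import HarnessLib
import Summits.NavierStokesRegularity.NavierStokesRegularity.Theorems.HalfSpaceWindowDoorCirculationCarryingRigidityDefs
import Summits.NavierStokesRegularity.NavierStokesRegularity.Theorems.HalfSpaceWindowDoorCirculationCarryingRigidityCriticalStretchingAnalytic

/-!
# Route `HalfSpaceWindowDoor`, crux `CirculationCarryingRigidity` (stmt-NavierStokesRegularity-25311) —
# the SUPPORT of the `e₃`-vorticity of a closed-hemisphere profile (unique continuation by analyticity)

Joint real-analyticity of `(t,y) ↦ ⟪curl v(t)(y), e₃⟫` on the slab `(−∞,0) × ℝ³`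
(`…CriticalStretchingAnalytic.analyticOnNhd_inner_curl_e3`, from the tree's `typeI_mild_analyticOnNhd`) and the
identity theorem on the (pre)connected slab give, for the census of the open stub
`NoExtremalHemisphereProfile ≡ HemisphereLiouvilleE3`:

* `inner_curl_e3_eq_zero_of_open` — a profile of the class whose `e₃`-vorticity vanishes on a nonempty OPEN subset
  of the slab is poloidal along `e₃` everywhere (no sign needed);
* `exists_pos_of_open` — for a circulation-carrying closed-hemisphere profile (`ω₃ ≥ 0`, `> 0` somewhere), the open
  set `{ω₃ > 0}` is DENSE in the slab: every nonempty open subset of the slab contains a point with `ω₃ > 0`;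
* `hemisphereLiouvilleE3_iff_open_zero_patch` — **BY-NAME REDUCTION**: the stub `HemisphereLiouvilleE3` is
  equivalent to «every closed-hemisphere profile of the class has an open space–time patch on which `ω₃ = 0`».

Seat ns-hsw-p1 g2 (LEAD of 25311, cell pub-ns-dss; helper `--supports` 25311).  WHAT THIS IS NOT: not a statement
about Navier–Stokes regularity — the door statements are regularity CRITERIA about HYPOTHETICAL blow-up profiles; a
reduction / structure theorem for the open stub, not its closure.
-/

noncomputable section

-- the summit and its single sub-problem share the name (CONVENTIONS §1), as in every Theorems file
set_option linter.dupNamespace false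

namespace Summit.NavierStokesRegularity.NavierStokesRegularity.Theorems.HalfSpaceWindowDoorCirculationCarryingRigidityHemisphereSupport

open Set Function Filter Topology Metric
open scoped RealInnerProductSpace InnerProductSpace
open Literature.Analysis Literature.Analysis.FluidPDE Literature.Analysis.UnboundedOperators
open Summit.NavierStokesRegularity.NavierStokesRegularity.Theorems
open Summit.NavierStokesRegularity.NavierStokesRegularity.Theorems.HalfSpaceWindowDoorCirculationCarryingRigidityDefs
open Summit.NavierStokesRegularity.NavierStokesRegularity.Theorems.HalfSpaceWindowDoorCirculationCarryingRigidityCriticalStretchingAnalytic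
  (analyticOnNhd_inner_curl_e3)

variable {C : ℝ} {v : ℝ → EuclideanSpace ℝ (Fin 3) → EuclideanSpace ℝ (Fin 3)}

/-- **Unique continuation of poloidality.**  If the `e₃`-vorticity of a profile of the class (Type-I rate, continuity
on the open slab, Oseen–Duhamel identity) vanishes on a nonempty open subset `O` of the slab `(−∞,0) × ℝ³`, then it
vanishes on the whole slab (identity theorem for the jointly real-analytic `(t,y) ↦ ⟪curl v(t)(y), e₃⟫` on the
preconnected slab). [cite: LemarieRieusset2016, Thm. 9.12] -/
theorem inner_curl_e3_eq_zero_of_open (hrate : HasTypeITimeDecay C v)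
    (hcont : ContinuousOn (uncurry v) (Iio (0 : ℝ) ×ˢ univ))
    (hmild : ∀ s t : ℝ, s < t → t < 0 → ∀ x, v t x = heatExtension (v s) (t - s) x - oseenDuhamel 1 s v v t x)
    {O : Set (ℝ × EuclideanSpace ℝ (Fin 3))} (hO : IsOpen O) (hne : O.Nonempty)
    (hsub : O ⊆ Iio (0 : ℝ) ×ˢ univ) (hzero : ∀ p ∈ O, ⟪curl (v p.1) p.2, e3⟫ = 0) :
    ∀ s < 0, ∀ y, ⟪curl (v s) y, e3⟫ = 0 := by
  intro s hs y
  obtain ⟨p₀, hp₀⟩ := hne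
  have han := analyticOnNhd_inner_curl_e3 hrate hcont hmild
  have hpre : IsPreconnected (Iio (0 : ℝ) ×ˢ (univ : Set (EuclideanSpace ℝ (Fin 3)))) :=
    isPreconnected_Iio.prod isPreconnected_univ
  have hev : (fun p : ℝ × EuclideanSpace ℝ (Fin 3) => ⟪curl (v p.1) p.2, e3⟫) =ᶠ[𝓝 p₀]
      (0 : ℝ × EuclideanSpace ℝ (Fin 3) → ℝ) := by
    filter_upwards [hO.mem_nhds hp₀] with p hp
    rw [Pi.zero_apply]
    exact hzero p hp
  have h := han.eqOn_zero_of_preconnected_of_eventuallyEq_zero hpre (hsub hp₀) hev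
  have h' := h (mk_mem_prod hs (mem_univ y))
  rw [Pi.zero_apply] at h'
  exact h'

/-- **The positivity set of a circulation-carrying closed-hemisphere profile is dense.**  If `⟪curl v, e₃⟫ ≥ 0` on
the slab and `> 0` at one point, then every nonempty open subset of the slab contains a point where
`⟪curl v, e₃⟫ > 0` (the zero set of a non-trivial real-analytic function has empty interior).
[cite: LemarieRieusset2016, Thm. 9.12] -/
theorem exists_pos_of_open (hrate : HasTypeITimeDecay C v)
    (hcont : ContinuousOn (uncurry v) (Iio (0 : ℝ) ×ˢ univ))
    (hmild : ∀ s t : ℝ, s < t → t < 0 → ∀ x, v t x = heatExtension (v s) (t - s) x - oseenDuhamel 1 s v v t x)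
    (hnn : ∀ s < 0, ∀ y, 0 ≤ ⟪curl (v s) y, e3⟫)
    {s₀ : ℝ} (hs₀ : s₀ < 0) {y₀ : EuclideanSpace ℝ (Fin 3)} (hpos : 0 < ⟪curl (v s₀) y₀, e3⟫)
    {O : Set (ℝ × EuclideanSpace ℝ (Fin 3))} (hO : IsOpen O) (hne : O.Nonempty)
    (hsub : O ⊆ Iio (0 : ℝ) ×ˢ univ) :
    ∃ p ∈ O, 0 < ⟪curl (v p.1) p.2, e3⟫ := by
  by_contra hcon
  push Not at hcon
  have hzero : ∀ p ∈ O, ⟪curl (v p.1) p.2, e3⟫ = 0 := fun p hp =>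
    le_antisymm (hcon p hp) (hnn p.1 (mem_prod.1 (hsub hp)).1 p.2)
  have h := inner_curl_e3_eq_zero_of_open hrate hcont hmild hO hne hsub hzero s₀ hs₀ y₀
  linarith

/-- **BY-NAME REDUCTION: the stub is an open-patch statement.**  `HemisphereLiouvilleE3` (closed-hemisphere profiles
of the class are poloidal along `e₃`) holds if and only if every closed-hemisphere profile of the class has SOME
nonempty open space–time patch inside the slab on which `⟪curl v, e₃⟫ = 0` (`→`: the whole slab is such a patch;
`←`: unique continuation `inner_curl_e3_eq_zero_of_open`). [cite: LemarieRieusset2016, Thm. 9.12] -/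
theorem hemisphereLiouvilleE3_iff_open_zero_patch :
    HemisphereLiouvilleE3 ↔
      ∀ (C : ℝ) (v : ℝ → EuclideanSpace ℝ (Fin 3) → EuclideanSpace ℝ (Fin 3)),
      Literature.Analysis.FluidPDE.HasTypeITimeDecay C v →
      ContinuousOn (Function.uncurry v) (Set.Iio (0 : ℝ) ×ˢ Set.univ) →
      (∀ s t : ℝ, s < t → t < 0 → ∀ x, v t x =
        Literature.Analysis.UnboundedOperators.heatExtension (v s) (t - s) x -
          Literature.Analysis.FluidPDE.oseenDuhamel 1 s v v t x) →
      (∀ t < 0, Literature.Analysis.FluidPDE.VectorCalculus.IsDivFree (v t)) →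
      (∀ s < 0, ∀ y, 0 ≤ ⟪Literature.Analysis.FluidPDE.curl (v s) y, e3⟫_ℝ) →
      ∃ O : Set (ℝ × EuclideanSpace ℝ (Fin 3)), IsOpen O ∧ O.Nonempty ∧ O ⊆ Set.Iio (0 : ℝ) ×ˢ Set.univ ∧
        ∀ p ∈ O, ⟪Literature.Analysis.FluidPDE.curl (v p.1) p.2, e3⟫_ℝ = 0 := by
  constructor
  · intro hL C v hrate hcont hmild hdiv hnn
    refine ⟨Iio (0 : ℝ) ×ˢ univ, isOpen_Iio.prod isOpen_univ, ⟨((-1 : ℝ), (0 : EuclideanSpace ℝ (Fin 3))),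
      mk_mem_prod (by norm_num) (mem_univ _)⟩, subset_rfl, fun p hp => ?_⟩
    exact hL C v hrate hcont hmild hdiv hnn p.1 (mem_prod.1 hp).1 p.2
  · intro h C v hrate hcont hmild hdiv hnn
    obtain ⟨O, hO, hne, hsub, hzero⟩ := h C v hrate hcont hmild hdiv hnn
    exact inner_curl_e3_eq_zero_of_open hrate hcont hmild hO hne hsub hzero

end Summit.NavierStokesRegularity.NavierStokesRegularity.Theorems.HalfSpaceWindowDoorCirculationCarryingRigidityHemisphereSupport

end
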